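import Mathlib
import Literature.Probability.LatticeModels.MeshDomainBulk
import HarnessLib

/-!
# Lattice-point counts in discs and the bulk of a socketed disc (`δℤ²`)

Topic: Probability / LatticeModels (companion to `MeshDomainBulk.lean`, `MeshDomainJordan.lean`).
Two elementary ingredients used to identify the largest mesh component `meshDomain Ω δ` of a
SOCKETED DISC `Ω ⊇ B(0, L) ∖ (B̄(p₀, r) ∪ B̄(p₁, r))` (a disc with two round plugs about two
marked points, the comparison domain of restriction arguments for lattice walks):

* Counting lattice points of `δℤ²` against area: the closed `δ`-discs about the lattice points of
  a disc `B(c, R)` cover `B(c, R - δ)` (`sq_sub_le_ncard_mul_sq`, lower count), and the open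
  `δ/2`-discs about distinct lattice points are disjoint (`ncard_mul_le_measureReal`, upper
  count; specialised to a closed disc, `ncard_closedBall_mul_sq_le`, and to an annulus,
  `ncard_annulus_mul_sq_le`).  Pattern of `volume_real_le_ncard_mul` / `ncard_mul_le_volume_real`
  of `MeshDomainBulk.lean`, with explicit constants.
* Geometry of the socketed disc in the rigid frame `φ z = ū (z - p₀)`, `u = (p₁ - p₀)/|p₁ - p₀|`
  (a parameter `φ` with its defining equation; `φ p₀ = 0`, `φ p₁ = d`): the five half-plane
  conditions `im φ > m`, `re φ < -m`, `im φ < -m`, `re φ > d + m`, `m < re φ < d - m` keep a point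
  at distance `> m` from both socket centres (`lt_dist_of_socketFar`), are stable under
  `η`-perturbation with margin loss `η` (`socketFar_of_norm_sub_le`), and hold at every point at
  distance `> 3m/2` from both centres (`socketFar_of_lt_dist`); intersected with a disc `B(0, M)`
  they give five CONVEX pieces whose union is preconnected, since consecutive pieces share
  explicit witnesses `p + u (a + b i)` (`isPreconnected_socketBulk`); `exists_socketBulk`
  packages the bulk as an anonymous preconnected set.

Folklore plane geometry; no source treats mesh components of socketed discs.  Not here: anything
about mesh graphs or `meshDomain` (see the Summits-side user).  Mathlib anchors:
`Convex.isPreconnected`, `IsPreconnected.union`, `convex_halfSpace_re_lt` (& co.), `Set.ncard`,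
`MeasureTheory.measureReal_biUnion_finset`, `MeasureTheory.measureReal_sdiff`,
`MeasureTheory.Measure.addHaar_real_closedBall`.  H21 anchors: `meshPoint`, `nearestSite`,
`dist_meshPoint_nearestSite_le`, `meshVertices_finite` (`DomainDiscretisation.lean`),
`le_dist_meshPoint_of_ne` (`MeshDomainBulk.lean`).
-/

namespace Literature.Probability.LatticeModels

open Set Metric MeasureTheory Filter Topology

noncomputable section

/-! ### Counting lattice points against area -/

/-- **Covering count.** The closed `δ`-balls about the lattice points of `δℤ²` in the disc
`B(c, R)` cover `B(c, R - δ)`, so there are at least `(R - δ)² / δ²` of them. [folklore] -/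
theorem sq_sub_le_ncard_mul_sq {δ R : ℝ} (hδ : 0 < δ) (hδR : δ ≤ R) (c : ℂ) :
    (R - δ) ^ 2 ≤ ({x : Site 2 | meshPoint δ x ∈ ball c R}.ncard : ℝ) * δ ^ 2 := by
  set P : Set (Site 2) := {x | meshPoint δ x ∈ ball c R} with hP
  have hPfin : P.Finite := meshVertices_finite (Ω := ball c R) isBounded_ball hδ
  set v : ℝ := volume.real (ball (0 : ℂ) 1) with hv_def
  have hv : 0 < v :=
    ENNReal.toReal_pos (measure_ball_pos volume (0 : ℂ) one_pos).ne' measure_ball_lt_top.ne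
  have hcover : ball c (R - δ) ⊆ ⋃ x ∈ hPfin.toFinset, closedBall (meshPoint δ x) δ := by
    intro z hz
    have hd : dist (meshPoint δ (nearestSite δ z)) z ≤ δ := dist_meshPoint_nearestSite_le hδ z
    have hn : nearestSite δ z ∈ P := by
      rw [hP, mem_setOf_eq, mem_ball]
      calc dist (meshPoint δ (nearestSite δ z)) c
          ≤ dist (meshPoint δ (nearestSite δ z)) z + dist z c := dist_triangle _ _ _
        _ < δ + (R - δ) := add_lt_add_of_le_of_lt hd (mem_ball.1 hz)
        _ = R := by ring
    exact mem_biUnion (hPfin.mem_toFinset.2 hn) (mem_closedBall'.2 hd)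
  have hfinU : volume (⋃ x ∈ hPfin.toFinset, closedBall (meshPoint δ x) δ) ≠ ⊤ :=
    ((measure_biUnion_finset_le _ _).trans_lt
      (ENNReal.sum_lt_top.2 fun _ _ => measure_closedBall_lt_top)).ne
  have h1 : (R - δ) ^ 2 * v ≤ (P.ncard : ℝ) * δ ^ 2 * v :=
    calc (R - δ) ^ 2 * v = volume.real (ball c (R - δ)) := by
          rw [← Measure.addHaar_real_closedBall_eq_addHaar_real_ball,
            Measure.addHaar_real_closedBall volume _ (by linarith), Complex.finrank_real_complex]
      _ ≤ volume.real (⋃ x ∈ hPfin.toFinset, closedBall (meshPoint δ x) δ) :=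
          measureReal_mono hcover hfinU
      _ ≤ ∑ x ∈ hPfin.toFinset, volume.real (closedBall (meshPoint δ x) δ) :=
          measureReal_biUnion_finset_le _ _
      _ = ∑ x ∈ hPfin.toFinset, δ ^ 2 * v := by
          refine Finset.sum_congr rfl fun x _ => ?_
          rw [Measure.addHaar_real_closedBall volume _ hδ.le, Complex.finrank_real_complex]
      _ = (P.ncard : ℝ) * δ ^ 2 * v := by
          rw [Finset.sum_const, nsmul_eq_mul, Set.ncard_eq_toFinset_card P hPfin, mul_assoc]
  exact le_of_mul_le_mul_right h1 hv

/-- **Packing count.** If the open `δ/2`-balls about the lattice points of a finite set `S` of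
sites lie in a set `T` of finite area, then `#S · (δ/2)² · area B(0,1) ≤ area T` (the small
balls are pairwise disjoint). [folklore] -/
theorem ncard_mul_le_measureReal {δ : ℝ} (hδ : 0 < δ) {S : Set (Site 2)} (hS : S.Finite)
    {T : Set ℂ} (hT : volume T ≠ ⊤) (h : ∀ x ∈ S, ball (meshPoint δ x) (δ / 2) ⊆ T) :
    (S.ncard : ℝ) * ((δ / 2) ^ 2 * volume.real (ball (0 : ℂ) 1)) ≤ volume.real T := by
  have hdisj : (hS.toFinset : Set (Site 2)).PairwiseDisjoint
      fun x => ball (meshPoint δ x) (δ / 2) := by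
    intro x _ y _ hxy
    refine Set.disjoint_left.2 fun p hpx hpy => ?_
    have hle := le_dist_meshPoint_of_ne hδ hxy
    have : dist (meshPoint δ x) (meshPoint δ y) < δ :=
      calc dist (meshPoint δ x) (meshPoint δ y)
          ≤ dist (meshPoint δ x) p + dist p (meshPoint δ y) := dist_triangle _ _ _
        _ < δ / 2 + δ / 2 := add_lt_add (by rwa [dist_comm, ← mem_ball]) (mem_ball.1 hpy)
        _ = δ := by ring
    linarith
  have hsub : (⋃ x ∈ hS.toFinset, ball (meshPoint δ x) (δ / 2)) ⊆ T := by
    intro p hp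
    simp only [mem_iUnion, Finite.mem_toFinset, exists_prop] at hp
    obtain ⟨x, hx, hpx⟩ := hp
    exact h x hx hpx
  calc (S.ncard : ℝ) * ((δ / 2) ^ 2 * volume.real (ball (0 : ℂ) 1))
      = ∑ x ∈ hS.toFinset, volume.real (ball (meshPoint δ x) (δ / 2)) := by
        rw [Set.ncard_eq_toFinset_card S hS, ← nsmul_eq_mul, ← Finset.sum_const]
        refine Finset.sum_congr rfl fun x _ => ?_
        rw [← Measure.addHaar_real_closedBall_eq_addHaar_real_ball volume (meshPoint δ x) (δ / 2),
          Measure.addHaar_real_closedBall volume _ (by positivity : (0 : ℝ) ≤ δ / 2),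
          Complex.finrank_real_complex]
    _ = volume.real (⋃ x ∈ hS.toFinset, ball (meshPoint δ x) (δ / 2)) :=
        (measureReal_biUnion_finset hdisj (fun _ _ => measurableSet_ball)
          (fun _ _ => measure_ball_lt_top.ne)).symm
    _ ≤ volume.real T := measureReal_mono hsub hT

/-- Lattice points of a closed disc of radius `ρ`: `N · (δ/2)² ≤ (ρ + δ/2)²`. [folklore] -/
theorem ncard_closedBall_mul_sq_le {δ ρ : ℝ} (hδ : 0 < δ) (hρ : 0 ≤ ρ) (p : ℂ) :
    ({x : Site 2 | meshPoint δ x ∈ closedBall p ρ}.ncard : ℝ) * (δ / 2) ^ 2 ≤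
      (ρ + δ / 2) ^ 2 := by
  set v : ℝ := volume.real (ball (0 : ℂ) 1) with hv_def
  have hv : 0 < v :=
    ENNReal.toReal_pos (measure_ball_pos volume (0 : ℂ) one_pos).ne' measure_ball_lt_top.ne
  have hS : {x : Site 2 | meshPoint δ x ∈ closedBall p ρ}.Finite :=
    meshVertices_finite (Ω := closedBall p ρ) isBounded_closedBall hδ
  have h := ncard_mul_le_measureReal hδ hS (T := ball p (ρ + δ / 2)) measure_ball_lt_top.ne
    (fun x hx z hz => by
      rw [mem_ball]
      have hx' : dist (meshPoint δ x) p ≤ ρ := mem_closedBall.1 hx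
      linarith [dist_triangle z (meshPoint δ x) p, mem_ball.1 hz])
  rw [← hv_def, ← Measure.addHaar_real_closedBall_eq_addHaar_real_ball,
    Measure.addHaar_real_closedBall volume p (by positivity : (0 : ℝ) ≤ ρ + δ / 2),
    Complex.finrank_real_complex, ← hv_def, ← mul_assoc] at h
  exact le_of_mul_le_mul_right h hv

/-- Lattice points of the annulus `M ≤ |z| < L`: `N · (δ/2)² ≤ (L + δ/2)² - (M - δ/2)²`.
[folklore] -/
theorem ncard_annulus_mul_sq_le {δ L M : ℝ} (hδ : 0 < δ) (hM : δ / 2 ≤ M) (hML : M ≤ L) :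
    ({x : Site 2 | meshPoint δ x ∈ ball (0 : ℂ) L ∧ M ≤ ‖meshPoint δ x‖}.ncard : ℝ) *
        (δ / 2) ^ 2 ≤ (L + δ / 2) ^ 2 - (M - δ / 2) ^ 2 := by
  set v : ℝ := volume.real (ball (0 : ℂ) 1) with hv_def
  have hv : 0 < v :=
    ENNReal.toReal_pos (measure_ball_pos volume (0 : ℂ) one_pos).ne' measure_ball_lt_top.ne
  have hS : {x : Site 2 | meshPoint δ x ∈ ball (0 : ℂ) L ∧ M ≤ ‖meshPoint δ x‖}.Finite :=
    (meshVertices_finite (Ω := ball (0 : ℂ) L) isBounded_ball hδ).subset fun x hx => hx.1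
  set T : Set ℂ := ball (0 : ℂ) (L + δ / 2) \ closedBall 0 (M - δ / 2) with hT_def
  have hTfin : volume T ≠ ⊤ := (measure_ball_lt_top.trans_le' (measure_mono sdiff_subset)).ne
  have h := ncard_mul_le_measureReal hδ hS hTfin (fun x hx z hz => by
    obtain ⟨hxL, hxM⟩ := hx
    rw [mem_ball_zero_iff] at hxL
    have hz' : dist z (meshPoint δ x) < δ / 2 := mem_ball.1 hz
    constructor
    · rw [mem_ball_zero_iff]
      calc ‖z‖ ≤ ‖z - meshPoint δ x‖ + ‖meshPoint δ x‖ := norm_le_norm_sub_add z _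
        _ < δ / 2 + L := by rw [← dist_eq_norm]; exact add_lt_add_of_lt_of_le hz' hxL.le
        _ = L + δ / 2 := by ring
    · rw [mem_closedBall_zero_iff, not_le]
      have := norm_le_norm_sub_add (meshPoint δ x) z
      rw [← dist_eq_norm, dist_comm] at this
      linarith)
  have hTvol : volume.real T = (L + δ / 2) ^ 2 * v - (M - δ / 2) ^ 2 * v := by
    rw [hT_def, measureReal_sdiff (closedBall_subset_ball (by linarith)) measurableSet_closedBall
      measure_ball_lt_top.ne, ← Measure.addHaar_real_closedBall_eq_addHaar_real_ball,
      Measure.addHaar_real_closedBall volume (0 : ℂ) (by linarith : (0 : ℝ) ≤ L + δ / 2),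
      Measure.addHaar_real_closedBall volume (0 : ℂ) (by linarith : (0 : ℝ) ≤ M - δ / 2),
      Complex.finrank_real_complex]
  rw [hTvol, ← sub_mul, ← hv_def, ← mul_assoc] at h
  exact le_of_mul_le_mul_right h hv

/-! ### The socket frame -/

section Frame

/-! The frame is a PARAMETER `φ` with its defining equation `hφ` (no definition and no
notation is introduced). -/

variable {p₀ u : ℂ} {d m M : ℝ} {φ : ℂ → ℂ}
variable (hφ : ∀ z, φ z = (starRingEnd ℂ) u * (z - p₀))
include hφ

/-- The frame is an isometry: `‖φ z‖ = ‖z - p₀‖`. [folklore] -/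
theorem norm_socketFrame (hu : ‖u‖ = 1) (z : ℂ) : ‖φ z‖ = ‖z - p₀‖ := by
  rw [hφ, norm_mul, Complex.norm_conj, hu, one_mul]

/-- Differences in the frame: `φ z - φ w = ū (z - w)`, so `‖φ z - φ w‖ = ‖z - w‖`. [folklore] -/
theorem norm_socketFrame_sub_socketFrame (hu : ‖u‖ = 1) (z w : ℂ) :
    ‖φ z - φ w‖ = ‖z - w‖ := by
  have : φ z - φ w = (starRingEnd ℂ) u * (z - w) := by rw [hφ, hφ]; ring
  rw [this, norm_mul, Complex.norm_conj, hu, one_mul]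

/-- The second socket centre `p₀ + u d` sits at `d`: `‖φ z - d‖ = ‖z - (p₀ + u d)‖`. [folklore] -/
theorem norm_socketFrame_sub_ofReal (hu : ‖u‖ = 1) (z : ℂ) (d : ℝ) :
    ‖φ z - d‖ = ‖z - (p₀ + u * d)‖ := by
  have h1 : (starRingEnd ℂ) u * u = 1 := by rw [Complex.conj_mul', hu]; norm_num
  rw [show φ z - d = (starRingEnd ℂ) u * (z - (p₀ + u * d)) by
    rw [hφ]; linear_combination (d : ℂ) * h1, norm_mul, Complex.norm_conj, hu, one_mul]

/-- The frame inverts the parametrisation `w ↦ p₀ + u w`. [folklore] -/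
theorem socketFrame_add_mul (hu : ‖u‖ = 1) (w : ℂ) : φ (p₀ + u * w) = w := by
  rw [hφ, add_sub_cancel_left, ← mul_assoc, Complex.conj_mul', hu]; norm_num

/-- The frame coordinates are `1`-Lipschitz: real part. [folklore] -/
theorem abs_re_socketFrame_sub_le (hu : ‖u‖ = 1) (z w : ℂ) :
    |(φ z).re - (φ w).re| ≤ ‖z - w‖ := by
  rw [← Complex.sub_re, ← norm_socketFrame_sub_socketFrame hφ hu z w]
  exact Complex.abs_re_le_norm _

/-- The frame coordinates are `1`-Lipschitz: imaginary part. [folklore] -/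
theorem abs_im_socketFrame_sub_le (hu : ‖u‖ = 1) (z w : ℂ) :
    |(φ z).im - (φ w).im| ≤ ‖z - w‖ := by
  rw [← Complex.sub_im, ← norm_socketFrame_sub_socketFrame hφ hu z w]
  exact Complex.abs_im_le_norm _

/-- The frame respects convex combinations (it is a real-affine map). [folklore] -/
theorem socketFrame_convex_comb (x y : ℂ) {a b : ℝ} (hab : a + b = 1) :
    φ (a • x + b • y) = a • φ x + b • φ y := by
  have hab' : (a : ℂ) + b = 1 := by exact_mod_cast hab
  simp only [hφ, Complex.real_smul]
  linear_combination ((starRingEnd ℂ) u * p₀) * hab'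

/-- Preimages of convex sets under the frame are convex. [folklore] -/
theorem convex_socketFrame_preimage {S : Set ℂ} (hS : Convex ℝ S) :
    Convex ℝ {z | φ z ∈ S} := by
  intro x hx y hy a b ha hb hab
  rw [mem_setOf_eq, socketFrame_convex_comb hφ x y hab]
  exact hS hx hy ha hb hab

/-! ### The five half-planes of the socketed disc -/

/-- A point satisfying one of the five conditions with margin `m` is at distance `> m` from both
socket centres `p₀` and `p₀ + u d`. [folklore] -/
theorem lt_dist_of_socketFar (hu : ‖u‖ = 1) (hd : 0 ≤ d) {z : ℂ}
    (h : m < (φ z).im ∨ (φ z).re < -m ∨ (φ z).im < -m ∨ d + m < (φ z).re ∨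
      (m < (φ z).re ∧ (φ z).re < d - m)) : m < ‖z - p₀‖ ∧ m < ‖z - (p₀ + u * d)‖ := by
  have hs := Complex.abs_re_le_norm (φ z)
  have ht := Complex.abs_im_le_norm (φ z)
  have hs' := Complex.abs_re_le_norm (φ z - d)
  have ht' := Complex.abs_im_le_norm (φ z - d)
  rw [norm_socketFrame hφ hu] at hs ht
  rw [norm_socketFrame_sub_ofReal hφ hu] at hs' ht'
  simp only [Complex.sub_re, Complex.ofReal_re, Complex.sub_im, Complex.ofReal_im,
    sub_zero] at hs' ht'
  rcases h with h | h | h | h | ⟨h, h'⟩ <;> constructor <;>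
    linarith [le_abs_self (φ z).re, neg_abs_le (φ z).re,
      le_abs_self (φ z).im, neg_abs_le (φ z).im,
      le_abs_self ((φ z).re - d), neg_abs_le ((φ z).re - d)]

/-- The five conditions are open with unit speed: margin `m + η` at `w` gives margin `m` on the
closed `η`-ball about `w`. [folklore] -/
theorem socketFar_of_norm_sub_le (hu : ‖u‖ = 1) {η : ℝ} {z w : ℂ}
    (h : m + η < (φ w).im ∨ (φ w).re < -(m + η) ∨ (φ w).im < -(m + η) ∨ d + (m + η) < (φ w).re ∨
      (m + η < (φ w).re ∧ (φ w).re < d - (m + η))) (hzw : ‖z - w‖ ≤ η) :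
    m < (φ z).im ∨ (φ z).re < -m ∨ (φ z).im < -m ∨ d + m < (φ z).re ∨
      (m < (φ z).re ∧ (φ z).re < d - m) := by
  have hs := abs_le.1 ((abs_re_socketFrame_sub_le hφ hu z w).trans hzw)
  have ht := abs_le.1 ((abs_im_socketFrame_sub_le hφ hu z w).trans hzw)
  rcases h with h | h | h | h | ⟨h, h'⟩
  · exact Or.inl (by linarith)
  · exact Or.inr (Or.inl (by linarith))
  · exact Or.inr (Or.inr (Or.inl (by linarith)))
  · exact Or.inr (Or.inr (Or.inr (Or.inl (by linarith))))
  · exact Or.inr (Or.inr (Or.inr (Or.inr ⟨by linarith, by linarith⟩)))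

/-- Conversely, a point at distance `> 3m/2` from both socket centres satisfies one of the five
conditions with margin `m` (the two `(2m) × (2m)` squares about the sockets lie in the two
`3m/2`-balls). [folklore] -/
theorem socketFar_of_lt_dist (hu : ‖u‖ = 1) (hm : 0 < m) {z : ℂ}
    (h₀ : 3 * m / 2 < ‖z - p₀‖) (h₁ : 3 * m / 2 < ‖z - (p₀ + u * d)‖) :
    m < (φ z).im ∨ (φ z).re < -m ∨ (φ z).im < -m ∨ d + m < (φ z).re ∨
      (m < (φ z).re ∧ (φ z).re < d - m) := by
  set s := (φ z).re with hs_def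
  set t := (φ z).im with ht_def
  by_cases ht : m < |t|
  · rcases lt_abs.1 ht with ht | ht
    · exact Or.inl ht
    · exact Or.inr (Or.inr (Or.inl (by linarith)))
  push Not at ht
  obtain ⟨ht1, ht2⟩ := abs_le.1 ht
  have hn0 : ‖z - p₀‖ ^ 2 = s * s + t * t := by
    rw [← norm_socketFrame hφ hu, Complex.sq_norm, Complex.normSq_apply]
  have hn1 : ‖z - (p₀ + u * d)‖ ^ 2 = (s - d) * (s - d) + t * t := by
    rw [← norm_socketFrame_sub_ofReal hφ hu, Complex.sq_norm, Complex.normSq_apply]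
    simp [hs_def, ht_def]
  have hq0 : (3 * m / 2) ^ 2 < ‖z - p₀‖ ^ 2 := by gcongr
  have hq1 : (3 * m / 2) ^ 2 < ‖z - (p₀ + u * d)‖ ^ 2 := by gcongr
  rw [hn0] at hq0
  rw [hn1] at hq1
  have hsm : m < |s| := by
    by_contra hle
    push Not at hle
    obtain ⟨h1, h2⟩ := abs_le.1 hle
    nlinarith
  have hsd : m < |s - d| := by
    by_contra hle
    push Not at hle
    obtain ⟨h1, h2⟩ := abs_le.1 hle
    nlinarith
  rcases lt_abs.1 hsm with hsm | hsm
  · rcases lt_abs.1 hsd with hsd | hsd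
    · exact Or.inr (Or.inr (Or.inr (Or.inl (by linarith))))
    · exact Or.inr (Or.inr (Or.inr (Or.inr ⟨hsm, by linarith⟩)))
  · exact Or.inr (Or.inl (by linarith))

/-! ### The bulk of the socketed disc -/

omit hφ in
/-- Membership in the bulk: in the disc, and one of the five conditions. [folklore] -/
theorem mem_socketBulk_iff {w : ℂ} :
    w ∈ ball (0 : ℂ) M ∩ {z | m < (φ z).im} ∪ ball (0 : ℂ) M ∩ {z | (φ z).re < -m} ∪
      ball (0 : ℂ) M ∩ {z | (φ z).im < -m} ∪ ball (0 : ℂ) M ∩ {z | d + m < (φ z).re} ∪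
      ball (0 : ℂ) M ∩ {z | m < (φ z).re ∧ (φ z).re < d - m} ↔
    ‖w‖ < M ∧ (m < (φ w).im ∨ (φ w).re < -m ∨ (φ w).im < -m ∨ d + m < (φ w).re ∨
      (m < (φ w).re ∧ (φ w).re < d - m)) := by
  simp only [mem_union, mem_inter_iff, mem_ball_zero_iff, mem_setOf_eq]; tauto

/-- The bulk of the socketed disc is preconnected: its five pieces are convex and consecutive
ones overlap (for a positive margin `m` with `2m < d` and both socket centres deeper than `3m`
inside the disc). [folklore] -/
theorem isPreconnected_socketBulk (hu : ‖u‖ = 1) (hm : 0 < m) (hmd : 2 * m < d)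
    (hp₀ : ‖p₀‖ + 3 * m < M) (hp₁ : ‖p₀ + u * d‖ + 3 * m < M) :
    IsPreconnected (ball (0 : ℂ) M ∩ {z | m < (φ z).im} ∪ ball (0 : ℂ) M ∩ {z | (φ z).re < -m} ∪
      ball (0 : ℂ) M ∩ {z | (φ z).im < -m} ∪ ball (0 : ℂ) M ∩ {z | d + m < (φ z).re} ∪
      ball (0 : ℂ) M ∩ {z | m < (φ z).re ∧ (φ z).re < d - m}) := by
  have hc : Convex ℝ (ball (0 : ℂ) M) := convex_ball 0 M
  have c1 : IsPreconnected (ball (0 : ℂ) M ∩ {z | m < (φ z).im}) :=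
    (hc.inter (convex_socketFrame_preimage hφ (convex_halfSpace_im_gt m))).isPreconnected
  have c2 : IsPreconnected (ball (0 : ℂ) M ∩ {z | (φ z).re < -m}) :=
    (hc.inter (convex_socketFrame_preimage hφ (convex_halfSpace_re_lt (-m)))).isPreconnected
  have c3 : IsPreconnected (ball (0 : ℂ) M ∩ {z | (φ z).im < -m}) :=
    (hc.inter (convex_socketFrame_preimage hφ (convex_halfSpace_im_lt (-m)))).isPreconnected
  have c4 : IsPreconnected (ball (0 : ℂ) M ∩ {z | d + m < (φ z).re}) :=
    (hc.inter (convex_socketFrame_preimage hφ (convex_halfSpace_re_gt (d + m)))).isPreconnected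
  have c5 : IsPreconnected
      (ball (0 : ℂ) M ∩ {z | m < (φ z).re ∧ (φ z).re < d - m}) :=
    (hc.inter ((convex_socketFrame_preimage hφ (convex_halfSpace_re_gt m)).inter
      (convex_socketFrame_preimage hφ (convex_halfSpace_re_lt (d - m))))).isPreconnected
  -- the offsets `a + b i` with `|a|, |b| ≤ 3m/2` have norm `≤ 3m`
  have hw : ∀ a b : ℝ, |a| ≤ 3 * m / 2 → |b| ≤ 3 * m / 2 →
      ‖(a : ℂ) + b * Complex.I‖ ≤ 3 * m := by
    intro a b ha hb
    calc ‖(a : ℂ) + b * Complex.I‖ ≤ |((a : ℂ) + b * Complex.I).re| +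
          |((a : ℂ) + b * Complex.I).im| := Complex.norm_le_abs_re_add_abs_im _
      _ ≤ 3 * m := by simp only [Complex.add_re, Complex.ofReal_re, Complex.mul_re,
          Complex.I_re, mul_zero, Complex.ofReal_im, Complex.I_im, mul_one, sub_self, add_zero,
          Complex.add_im, Complex.mul_im, zero_add]; linarith
  have hk : |3 * m / 2| ≤ 3 * m / 2 := (abs_of_pos (by positivity)).le
  have hk' : |-(3 * m / 2)| ≤ 3 * m / 2 := by rw [abs_neg]; exact hk
  -- a witness `p + u (a + b i)` based at `p = p₀ + u c`: disc condition, socketFrame coordinates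
  have key : ∀ (p : ℂ) (c a b : ℝ), p = p₀ + u * c → ‖p‖ + ‖(a : ℂ) + b * Complex.I‖ < M →
      p + u * ((a : ℂ) + b * Complex.I) ∈ ball (0 : ℂ) M ∧
        (φ (p + u * ((a : ℂ) + b * Complex.I))).re = c + a ∧
        (φ (p + u * ((a : ℂ) + b * Complex.I))).im = b := by
    intro p c a b hp h
    refine ⟨mem_ball_zero_iff.2 ((norm_add_le _ _).trans_lt (by rwa [norm_mul, hu, one_mul])), ?_⟩
    have : p + u * ((a : ℂ) + b * Complex.I) = p₀ + u * ((c : ℂ) + a + b * Complex.I) := by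
      rw [hp]; ring
    rw [this, socketFrame_add_mul hφ hu]
    constructor <;> simp
  -- the four witnesses
  obtain ⟨m1, r1, i1⟩ := key p₀ 0 (-(3 * m / 2)) (3 * m / 2) (by simp)
    (by linarith [hw _ _ hk' hk])
  obtain ⟨m2, r2, i2⟩ := key p₀ 0 (-(3 * m / 2)) (-(3 * m / 2)) (by simp)
    (by linarith [hw _ _ hk' hk'])
  obtain ⟨m3, r3, i3⟩ := key (p₀ + u * d) d (3 * m / 2) (3 * m / 2) rfl
    (by linarith [hw _ _ hk hk])
  obtain ⟨m4, r4, i4⟩ := key (p₀ + u * (d / 2 : ℝ)) (d / 2) 0 (3 * m / 2) rfl (by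
    have h2 : p₀ + u * (d / 2 : ℝ) = (2⁻¹ : ℂ) * (p₀ + (p₀ + u * d)) := by push_cast; ring
    have : ‖p₀ + u * (d / 2 : ℝ)‖ ≤ (‖p₀‖ + ‖p₀ + u * d‖) / 2 := by
      rw [h2, norm_mul, norm_inv, Complex.norm_two]
      linarith [norm_add_le p₀ (p₀ + u * d)]
    have h0 : |(0 : ℝ)| ≤ 3 * m / 2 := by rw [abs_zero]; positivity
    linarith [hw _ _ h0 hk])
  refine IsPreconnected.union _ (Or.inl (Or.inl (Or.inl ⟨m4, ?_⟩))) ⟨m4, ?_⟩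
    (IsPreconnected.union _ (Or.inl (Or.inl ⟨m3, ?_⟩)) ⟨m3, ?_⟩
      (IsPreconnected.union _ (Or.inr ⟨m2, ?_⟩) ⟨m2, ?_⟩
        (IsPreconnected.union _ ⟨m1, ?_⟩ ⟨m1, ?_⟩ c1 c2) c3) c4) c5
  all_goals simp only [mem_setOf_eq, r1, i1, r2, i2, r3, i3, r4, i4]
  all_goals first | (constructor <;> linarith) | linarith

end Frame

/-- **The bulk of the socketed disc, packaged**: for a unit direction `u`, a margin `m > 0` with
`2m < d`, and a disc `B(0, M)` containing both socket centres `p₀`, `p₀ + u d` at depth `> 3m`,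
there is a preconnected `V ⊆ B(0, M)` containing every point of the disc at distance `> 3m/2`
from both centres, all of whose points stay at distance `> m - |z - w|` from both centres when
moved to `z`. [folklore] -/
theorem exists_socketBulk {p₀ u : ℂ} {d m M : ℝ} (hu : ‖u‖ = 1) (hm : 0 < m) (hmd : 2 * m < d)
    (hp₀ : ‖p₀‖ + 3 * m < M) (hp₁ : ‖p₀ + u * d‖ + 3 * m < M) :
    ∃ V : Set ℂ, IsPreconnected V ∧ V ⊆ ball 0 M ∧
      (∀ z : ℂ, ‖z‖ < M → 3 * m / 2 < ‖z - p₀‖ → 3 * m / 2 < ‖z - (p₀ + u * d)‖ → z ∈ V) ∧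
      (∀ w ∈ V, ∀ z : ℂ, m - ‖z - w‖ < ‖z - p₀‖ ∧ m - ‖z - w‖ < ‖z - (p₀ + u * d)‖) := by
  have hφ : ∀ z, (fun z => (starRingEnd ℂ) u * (z - p₀)) z = (starRingEnd ℂ) u * (z - p₀) :=
    fun z => rfl
  refine ⟨_, isPreconnected_socketBulk hφ hu hm hmd hp₀ hp₁, fun z hz => ?_,
    fun z hzM h₀ h₁ => ?_, fun w hw z => ?_⟩
  · exact mem_ball_zero_iff.2 (mem_socketBulk_iff.1 hz).1
  · exact mem_socketBulk_iff.2 ⟨hzM, socketFar_of_lt_dist hφ hu hm h₀ h₁⟩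
  · have hw' := (mem_socketBulk_iff.1 hw).2
    exact lt_dist_of_socketFar hφ hu (by linarith) (socketFar_of_norm_sub_le hφ hu (η := ‖z - w‖)
      (m := m - ‖z - w‖) (by simpa using hw') le_rfl)

end

end Literature.Probability.LatticeModels
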